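import Literature.AnabelianGeometry.SemiGraphs.PSCSmoothCurveGenuineCuspRank
import HarnessLib

/-!
# [CombGC] Rmk. 1.3.1 `CuspRank` at EVERY level of a genuine smooth curve, and `RankStatementsHold` there

Mochizuki, *A combinatorial version of the Grothendieck conjecture* [CombGC], Tohoku Math. J. **59**
(2007), Rmk. 1.1.3 p. 8 and Rmk. 1.3.1 p. 10 ("if `G` has cusps, then the rank of `M^cusp_G` is equal to
`r(G) − 1`", at every finite étale covering), typed as `PSCDatum.CuspRank` and bundled with
`AbelianizedGrphRank`, `DualityRankEq`, `NoncuspidalIffCuspFilTrivial` into `RankStatementsHold Ω` (F-3098).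
[cite: MochizukiCombGC2007, Rmk 1.3.1 p.10] [cite: MochizukiCombGC2007, Rmk 1.1.3 p.8]

PROOF-ONLY file (abc-iut cell, layer L3, [CombGC] non-vacuity programme; seat abc-iut-w5-d195 gen 7,
brick «SC-GENUINE-COVERING-CLOSED», part K4; sequel of `PSCSmoothCurveGenuineCuspRank.lean`).

* `cuspRank_of_smoothCurveGenuine` — **`CuspRank` HOLDS at a genuine smooth-curve datum**: every open
  level `U` is again a genuine smooth curve (`restrict_smoothCurveGenuine`) of type `(g_U, r_U)` with
  `r_U = cuspCount U`; its `M^cusp` at the trivial level is the pro-`Σ` completion of `ℤ^{r_U − 1}`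
  (`exists_cuspRank_top_of_smoothCurveGenuine`), transported to `G` at level `U` along `U ↪ Π`
  (abc-iut-w5-d226's `map_subtype_cuspFil`, `isProSigmaCompletion_transfer_of_map_eq`);
* `rankStatementsHold_of_smoothCurveGenuine` — **F-3098 `RankStatementsHold Ω` at every origin of genuine
  smooth-curve data** (Rmk. 1.1.3 by abc-iut-w5-d183's `abelianizedGrphRank_of_smoothProper`; Rmk. 1.3.1
  first / third claims `dualityRankEq_of_isEmpty` / `noncuspidalIffCuspFilTrivial_of_smoothCurveGenuine`;
  second claim here).  Together with `PSCSmoothCurveGenuineCuspidal` / `…Inputs` this supplies, at the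
  pro-`ℓ` genuine smooth-curve origin, EVERY origin-level input of the tree's Thm. 1.6 (iii) assembly
  `unrVerticialIff_holds_of_inputs'` (the joint statement is the sequel's one-liner).

0 definitions; consistency / non-vacuity evidence at genuine data, not the printed theorems for all pointed
stable curves; nothing here takes a side on [IUTchIII] Cor. 3.12.
-/

noncomputable section

namespace Literature.AnabelianGeometry.SemiGraphs

namespace PSCDatum

open scoped Pointwise
open Literature.GroupTheory.CombinatorialGroupTheory
open Literature.GroupTheory.CombinatorialGroupTheory.PuncturedSurfaceGroup (cuspInertia IsHyperbolicType)
open Literature.AnabelianGeometry.Anabelioids (IsSigmaInteger)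
open SemiGraphOfAnabelioids (IsProSigmaCompletion)
open SemiGraphOfAnabelioids.IsProSigmaCompletion (exists_isProSigmaCompletion)

universe u

variable {P : Type u} [Group P] [TopologicalSpace P] [IsTopologicalGroup P]

/-! ### `CuspRank` at every level -/

section Datum

variable [CompactSpace P] [TotallyDisconnectedSpace P] (G : PSCDatum P) [IsEmpty G.graph.N] {g r : ℕ}

/-- **[CombGC] Rmk. 1.3.1, second claim (`CuspRank`), HOLDS at a genuine smooth-curve datum**: at every
open level `U` with `r(G_U) > 0`, `M^cusp_{G_U} = cuspFil U ⧸ closure[U,U]` is the pro-`Σ` completion of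
`ℤ^{r(G_U) − 1}`. [cite: MochizukiCombGC2007, Rmk 1.3.1 p.10] -/
theorem cuspRank_of_smoothCurveGenuine (hV : ∀ v, G.vertGp v = ⊤) (v₀ : G.graph.V) (hv : ∀ w, w = v₀)
    (h : IsHyperbolicType g r) (ι : PuncturedSurfaceGroup g r →* P) (hι : IsProSigmaCompletion G.Sigma ι)
    (e : G.graph.C ≃ Fin r)
    (hC : ∀ c, ∃ δ : ConjAct P,
      G.cuspGp c = δ • ((cuspInertia (g := g) (e c)).map ι).topologicalClosure)
    (hgen : ∀ v, G.genus v = g) : G.CuspRank := by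
  intro U hU hpos hn
  haveI : U.FiniteIndex := IsProSigma.finiteIndex_of_isOpen G.proSigma U hU
  haveI : CompactSpace U := isCompact_iff_compactSpace.mp (U.isClosed_of_isOpen hU).isCompact
  obtain ⟨hN', hV', ⟨w₀, hw⟩, g', r'', ι', e', -, hι', -, hgen', hC'⟩ :=
    G.restrict_smoothCurveGenuine U hU hV v₀ hv h ι hι e hC hgen
  haveI := hN'
  -- `r(G_U) = cuspCount U = r' + 1`
  have hr'' : r'' = G.cuspCount U := by
    have h1 := Fintype.card_congr e'
    rw [Fintype.card_fin] at h1
    rw [← h1]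
    exact G.restrict_graph_r U hU
  obtain ⟨r', hr'⟩ : ∃ r', r'' = r' + 1 := ⟨r'' - 1, by omega⟩
  subst hr'
  have hsub : G.cuspCount U - 1 = r' := by omega
  -- the kernel `closure[U,U]` upstairs and downstairs
  set K : Subgroup U := ((⁅(⊤ : Subgroup U), (⊤ : Subgroup U)⁆ : Subgroup U).topologicalClosure) with hK
  have hKmap : K.map U.subtype = ((⁅U, U⁆ : Subgroup P).topologicalClosure) := by
    rw [hK, ← topologicalClosure_map_of_isClosedEmbedding U.subtype
      (U.isClosed_of_isOpen hU).isClosedEmbedding_subtypeVal, Subgroup.map_commutator,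
      ← MonoidHom.range_eq_map, Subgroup.range_subtype]
  have hBmap : ((G.restrict U hU).cuspFil ⊤).map U.subtype = G.cuspFil U := by
    rw [G.map_subtype_cuspFil hU ⊤, ← MonoidHom.range_eq_map, Subgroup.range_subtype]
  haveI hKn : K.Normal := by rw [hK]; exact Subgroup.is_normal_topologicalClosure _
  haveI : (K.subgroupOf ((G.restrict U hU).cuspFil ⊤)).Normal := inferInstance
  obtain ⟨ιc, hιc⟩ :=
    (G.restrict U hU).exists_cuspRank_top_of_smoothCurveGenuine ι' hι' e' hC'
  obtain ⟨ι₂, hι₂⟩ := isProSigmaCompletion_transfer_of_map_eq ((G.restrict U hU).cuspFil ⊤) K hBmap hKmap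
    ιc hιc
  rw [hsub]
  exact ⟨ι₂, hι₂⟩

end Datum

/-! ### F-3098 `RankStatementsHold` at origins of genuine smooth-curve data -/

section Origin

variable (Ω : PSCOrigin.{u})

/-- **F-3098 `RankStatementsHold Ω` HOLDS at every origin of genuine smooth-curve data** (profinite
carriers, one vertex `Π_v = Π`, no nodes, cusp groups conjugates of closed cusp inertia groups of a pro-`Σ`
completion of a hyperbolic `Γ_{g,r}`, `genus = g`): Rmk. 1.1.3 (rank `0`), Rmk. 1.3.1 first claim
(ranks `0`), second claim (`CuspRank`, rank `r(G_U) − 1` at every level), third claim (noncuspidal iff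
every `M^cusp = 0`). [cite: MochizukiCombGC2007, Rmk 1.3.1 p.10] -/
theorem rankStatementsHold_of_smoothCurveGenuine
    (hΩ : ∀ ⦃Q : Type u⦄ [Group Q] [TopologicalSpace Q] [IsTopologicalGroup Q] (G : PSCDatum Q),
      Ω.IsOfPSCType G → CompactSpace Q ∧ T2Space Q ∧ TotallyDisconnectedSpace Q ∧ IsEmpty G.graph.N ∧
        (∀ v, G.vertGp v = ⊤) ∧ (∃ v₀ : G.graph.V, ∀ w, w = v₀) ∧
        ∃ (g r : ℕ) (ι : PuncturedSurfaceGroup g r →* Q) (e : G.graph.C ≃ Fin r),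
          IsHyperbolicType g r ∧ IsProSigmaCompletion G.Sigma ι ∧ (∀ v, G.genus v = g) ∧
          ∀ c, ∃ δ : ConjAct Q, G.cuspGp c =
            δ • ((cuspInertia (g := g) (e c)).map ι).topologicalClosure) :
    RankStatementsHold Ω := by
  intro Q _ _ _ G hG
  obtain ⟨hc, ht, hd, hN, hV, ⟨v₀, hv⟩, g, r, ι, e, hgr, hι, hgen, hC⟩ := hΩ G hG
  haveI := hc; haveI := ht; haveI := hd; haveI := hN
  exact ⟨G.abelianizedGrphRank_of_smoothProper hV v₀ hv, G.dualityRankEq_of_isEmpty hV v₀,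
    G.cuspRank_of_smoothCurveGenuine hV v₀ hv hgr ι hι e hC hgen,
    G.noncuspidalIffCuspFilTrivial_of_smoothCurveGenuine hV v₀ hv hgr ι hι e hC hgen⟩

end Origin

end PSCDatum

end Literature.AnabelianGeometry.SemiGraphs

end
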